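import Literature.MathematicalPhysics.QuantumFieldTheory.Balaban1983to89.Node00.OpsYSectDReal
import Literature.MathematicalPhysics.QuantumFieldTheory.Balaban1983to89.Node00.OpsYRecordV4P

/-!
# `Balaban1983to89.Node00.OpsYDelta2FormP` — T. Bałaban, *Propagators for lattice gauge theories in a background field*, Commun. Math. Phys. **99**
# (1985) 389–434 [Balaban1985BackgroundPropagators], (3.134) p. 422 with (3.126) p. 420: THE RESIDUAL LETTER `Δ⁽²⁾(U)` AS A FUNCTION OF [5]'s FORM
# LETTER `C⁽²⁾`, FED THE PRINT-UNITS SITE PROPAGATOR `G′_phys = η²·G′` — `res134OfC2YP`, ★★ `resYOfC2P`, its (3.134), trace symmetry, covariance,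
# reality and ★★★ the N06 certificate's `hΔ2` binder AS A THEOREM at `𝔯 := resYOfC2P 𝔠`

statement-level skeleton of published theorems with citation tags; proofs where landed; nothing here is a claim about the Yang–Mills mass gap

THE POINT (cell bus I.32294, dag-n06-l g33's ONE ASK to NODE 00; dag-lead WORDS 266 I.32297).  def-Y's `Node00.OpsYDelta2Form` §4 typed the residual
letter of (3.134) as a FUNCTION `res134OfC2Y 𝔡 x 𝔠` ∕ `resYOfC2 𝔠` of the external form letter `𝔠` ([5]'s polarised `C⁽²⁾(U; ·, ·)`), built over the
v4 record's `H(U)` — `HDY` fed the LATTICE-units site propagator `GpY`.  The N06 certificate of record (`…N06AtOpsYNuOfRecordV6EPairVB` and successors)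
reads its Sect. D∕E letters through the v4P record `Node00.OpsYRecordV4P`, i.e. through `H(U)` fed the PRINT-units propagator
`GpPhysY i par = η² • GpY i par` (`covLettersY_v4P_H`).  THIS FILE is the `G′_phys` twin of `OpsYDelta2Form` §4–§9 and `OpsYSectDReal` §RecordSymm —
no new mathematics, every proof is the `GpY` chain re-instantiated at `G′_phys`:
* §1 `res134OfC2YP 𝔡 x 𝔠 : ResLettersY 𝔸 x` (`Δ⁽²⁾ := delta2OfY 𝔡 … (GpPhysY …) 𝔠.form`, its `U = 1` clause PROVED by `delta2OfY_one`), `res134OfC2YP_Δ2`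
  (rfl), `trPairY_res134OfC2YP` ((3.134) at the v4P record's `H`), `trPairY_res134OfC2YP_symm`, `res134OfC2YP_flat_Δ2`, `res134OfC2YP_Δ2_isCovBondOpY`;
* §2 ★★ `resYOfC2P 𝔠 : ResY N θ Mstar` (member by member at the trace-dual fibre of record `M_N(ℂ)`), `resYOfC2P_apply`, ★ `resYOfC2P_Δ2` (rfl),
  `sum_trace_resYOfC2P_Δ2` ((3.134) in matrix traces), `sum_trace_resYOfC2P_Δ2_symm`, `resYOfC2P_flat_Δ2`, ★ `resYOfC2P_Δ2_isCovBondOpY` (covariance for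
  a covariant `𝔠`);
* §3 reality and the Hermitian symmetry: `isRealOpY_GpPhysY_parSymY` (= the N05 door file's `GpPhysY_parSymY_isRealOpY`, restated below NODE 00's import ceiling), `HDY_physY_record_isRealOpY`, `HDY_physY_star_of_unitary`, `hH_of_recordP`,
  `resYOfC2P_Δ2_star`, `resYOfC2P_Δ2_isRealOpY`, ★★ `resYOfC2P_Δ2_isSymmTr` (unitary-valued `U`, reality of `(𝔠 x).form` at `U`) and ★★★
  `resYOfC2P_Δ2_isSymmTr_SU` — the certificate's displayed binder
  `hΔ2 : ∀ x U, (∀ μ z, U μ z ∈ specialUnitaryUnits (Fin N)) → IsSymmTr (fun _ => 1) ((𝔯 x).Δ2 U)` VERBATIM at `𝔯 := resYOfC2P N θ Mstar 𝔠`, modulo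
  the ONE displayed reality letter `h𝔠real` on `𝔠`.
CONSUMER RECIPE (n06-d, the edition after «VJ»): substitute `𝔯 := resYOfC2P N θ.toStage3Params Mstar 𝔠` in `opsYNuStOfRecordV4PE … 𝔯 …` and set
`hΔ2 := resYOfC2P_Δ2_isSymmTr_SU θ.toStage3Params Mstar 𝔠 h𝔠real`; `hD2sup` then speaks about `delta2OfY (trDualMatY N) x.toKIdx (parSymY …) (parBY …)
(GpPhysY … (parSymY …)) (𝔠 x).form` (`resYOfC2P_Δ2`), the object of dag-n06-l's ROAD P-D2 legs.
HONEST SCOPE.  Definitions with bodies and bookkeeping∕algebra over def-Y's letters; [5]'s `C⁽²⁾` is NOT an object of the tree (flat witness only) and stays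
a PARAMETER `𝔠`; nothing of [B9] or [5] asserted; COUNT-NEUTRAL (`--supports stmt-QuantumFields-20541`); N06 NOT discharged; K1⁹ NOT closed.  One finite
lattice at a time — nothing continuum ∕ ℝ⁴ ∕ OS ∕ mass gap ∕ Clay.  Cell `pub-ymgap` (HUMAN RULING D-0062), Track A NODE 00, seat `pub-ymgap-node00-def-Y`
(g29), 2026-08-30.
-/

noncomputable section

namespace Literature.MathematicalPhysics.QuantumFieldTheory.Balaban1983to89.Node00

open B6KLevelCensusIndexV1 (KIdx)
open B9PinMembersKLevelV1 (MemberY)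
open B9Thm311ReadingCoords (trIP IsSymmTr)
open B9Eq3132SectDLetters (HDY GDY)
open B7Prop2SpecialUnitary (specialUnitaryUnits specialUnitaryUnits_le_unitaryUnits)
open scoped Matrix
open scoped Matrix.Norms.L2Operator

/-! ## §1 The residual letter fed `G′_phys`, as a function of `C⁽²⁾`, at a member -/

section Residual

variable {d ℓ : ℕ} {hd : 1 ≤ d + 1} {hL : Odd (ℓ + 1) ∧ 1 < ℓ + 1} {b₀ b₁ : ℝ} {Mstar : ℕ}
variable {𝔸 : Type} [NormedRing 𝔸] [NormedAlgebra ℂ 𝔸] [CompleteSpace 𝔸] (𝔡 : TrDualY 𝔸)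

/-- ★★ **THE RESIDUAL LETTER OF (3.134) AS A FUNCTION OF `C⁽²⁾`, FED `G′_phys`** at a member: `Δ⁽²⁾(U)` built from the v4P record's `H` (`HDY` over
`parSymY`, `parBY`, `GpPhysY parSymY` — `covLettersY_v4P_H`) and r06's `J`, with its `U = 1` clause PROVED.
[cite: Balaban1985BackgroundPropagators, (3.134) p.422, (3.126) p.420, (3.117) p.419] -/
def res134OfC2YP (x : MemberY d ℓ hd hL b₀ b₁ Mstar) (𝔠 : C2LettersY 𝔸 x.toKIdx) : ResLettersY 𝔸 x :=
  ⟨delta2OfY 𝔡 x.toKIdx (parSymY x.toKIdx) (parBY x.toKIdx) (GpPhysY x.toKIdx (parSymY x.toKIdx)) 𝔠.form,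
    delta2OfY_one 𝔡 x.toKIdx (parSymY x.toKIdx) (parBY x.toKIdx) (GpPhysY x.toKIdx (parSymY x.toKIdx)) 𝔠.form⟩

/-- the residual letter's `Δ⁽²⁾`, unfolded. [cite: Balaban1985BackgroundPropagators, (3.134) p.422, bookkeeping] -/
theorem res134OfC2YP_Δ2 (x : MemberY d ℓ hd hL b₀ b₁ Mstar) (𝔠 : C2LettersY 𝔸 x.toKIdx) :
    (res134OfC2YP 𝔡 x 𝔠).Δ2 = delta2OfY 𝔡 x.toKIdx (parSymY x.toKIdx) (parBY x.toKIdx) (GpPhysY x.toKIdx (parSymY x.toKIdx)) 𝔠.form := rfl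

/-- ★ (3.134) for the residual letter at the v4P record's `H`: `⟨A′, Δ⁽²⁾A⟩_τ = 2⟨HC⁽²⁾(A, A′), J⟩_τ`. [cite: Balaban1985BackgroundPropagators, (3.134) p.422] -/
theorem trPairY_res134OfC2YP (x : MemberY d ℓ hd hL b₀ b₁ Mstar) (𝔠 : C2LettersY 𝔸 x.toKIdx) (U : CfgY 𝔸 x.toKIdx) (A A' : FBondY x.toKIdx → 𝔸) :
    trPairY 𝔡.τ A' ((res134OfC2YP 𝔡 x 𝔠).Δ2 U A) =
      2 * trPairY 𝔡.τ (HDY x.toKIdx (parSymY x.toKIdx) (parBY x.toKIdx) (GpPhysY x.toKIdx (parSymY x.toKIdx)) U (𝔠.form U A A')) (JY x.toKIdx U) :=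
  trPairY_delta2OfY 𝔡 _ _ _ _ _ U A A'

/-- `τ`-symmetry `⟨Δ⁽²⁾A, B⟩_τ = ⟨A, Δ⁽²⁾B⟩_τ` of the residual letter fed `G′_phys` (from the symmetry of the polarised form).
[cite: Balaban1985BackgroundPropagators, (3.134) p.422, bookkeeping] -/
theorem trPairY_res134OfC2YP_symm (x : MemberY d ℓ hd hL b₀ b₁ Mstar) (𝔠 : C2LettersY 𝔸 x.toKIdx) (U : CfgY 𝔸 x.toKIdx) (A B : FBondY x.toKIdx → 𝔸) :
    trPairY 𝔡.τ ((res134OfC2YP 𝔡 x 𝔠).Δ2 U A) B = trPairY 𝔡.τ A ((res134OfC2YP 𝔡 x 𝔠).Δ2 U B) :=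
  trPairY_delta2OfY_symm' 𝔡 _ _ _ _ _ 𝔠.symm U A B

/-- the flat `C⁽²⁾` gives the flat residual letter's `Δ⁽²⁾ = 0`. [cite: Balaban1985BackgroundPropagators, (3.134) p.422, bookkeeping] -/
theorem res134OfC2YP_flat_Δ2 (x : MemberY d ℓ hd hL b₀ b₁ Mstar) (U : CfgY 𝔸 x.toKIdx) :
    (res134OfC2YP 𝔡 x (c2LettersY_flat 𝔸 x.toKIdx)).Δ2 U = 0 :=
  delta2OfY_flat 𝔡 _ _ _ _ U

/-- ★ the residual letter fed `G′_phys` is gauge COVARIANT for a covariant form letter (`HDY_cov` at `GpPhysY_isCovSiteOpY`).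
[cite: Balaban1985BackgroundPropagators, (3.134) p.422, (3.34) p.396] -/
theorem res134OfC2YP_Δ2_isCovBondOpY (x : MemberY d ℓ hd hL b₀ b₁ Mstar) (𝔠 : C2LettersY 𝔸 x.toKIdx) (hC : 𝔠.IsCov) :
    IsCovBondOpY x.toKIdx (res134OfC2YP 𝔡 x 𝔠).Δ2 := by
  have hS := parSymY_isGaugeLawS (𝔸 := 𝔸) x.toKIdx
  have hB := parBY_isGaugeLawB (𝔸 := 𝔸) x.toKIdx
  have hGp := GpPhysY_isCovSiteOpY hS
  rw [res134OfC2YP_Δ2]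
  exact delta2OfY_isCovBondOpY 𝔡 x.toKIdx _ _ _ 𝔠.form (fun g U => HDY_cov hS hB hGp) hC

end Residual

/-! ## §2 At the record: ★★ `resYOfC2P` -/

section Record

variable (N : ℕ) (θ : Stage3Params) (Mstar : ℕ)

/-- ★★ **THE RESIDUAL FAMILY OF RECORD AS A FUNCTION OF `C⁽²⁾`, FED `G′_phys`**: member by member `res134OfC2YP` at the trace-dual fibre of record
`M_N(ℂ)` — the pin `𝔯 := resYOfC2P 𝔠` of the N06 certificate's free residual datum. [cite: Balaban1985BackgroundPropagators, (3.134) p.422, (3.126) p.420] -/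
def resYOfC2P (𝔠 : C2Y N θ Mstar) : ResY N θ Mstar := fun x => res134OfC2YP (trDualMatY N) x (𝔠 x)

variable (𝔠 : C2Y N θ Mstar)

/-- `resYOfC2P`, member by member. [cite: Balaban1985BackgroundPropagators, (3.134) p.422, bookkeeping] -/
theorem resYOfC2P_apply (x : MemberY θ.d₆ θ.ℓ₆ θ.hd' θ.hL' θ.b₀ θ.b₁ Mstar) : resYOfC2P N θ Mstar 𝔠 x = res134OfC2YP (trDualMatY N) x (𝔠 x) := rfl

/-- ★ the residual family's `Δ⁽²⁾` at a member, unfolded to `delta2OfY` at the v4P record's `H` (fed `G′_phys`).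
[cite: Balaban1985BackgroundPropagators, (3.134) p.422, bookkeeping] -/
theorem resYOfC2P_Δ2 (x : MemberY θ.d₆ θ.ℓ₆ θ.hd' θ.hL' θ.b₀ θ.b₁ Mstar) :
    (resYOfC2P N θ Mstar 𝔠 x).Δ2 =
      delta2OfY (trDualMatY N) x.toKIdx (parSymY x.toKIdx) (parBY x.toKIdx) (GpPhysY x.toKIdx (parSymY x.toKIdx)) (𝔠 x).form := rfl

/-- ★ (3.134) at the record fed `G′_phys`, in matrix traces: `Σ_b tr(A′(b)·(Δ⁽²⁾(U)A)(b)) = 2·Σ_b tr((H(U)C⁽²⁾(U; A, A′))(b)·J(U)(b))`.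
[cite: Balaban1985BackgroundPropagators, (3.134) p.422, (3.136) p.422] -/
theorem sum_trace_resYOfC2P_Δ2 (x : MemberY θ.d₆ θ.ℓ₆ θ.hd' θ.hL' θ.b₀ θ.b₁ Mstar) (U : CfgY (Matrix (Fin N) (Fin N) ℂ) x.toKIdx)
    (A A' : FBondY x.toKIdx → Matrix (Fin N) (Fin N) ℂ) :
    ∑ b, Matrix.trace (A' b * (resYOfC2P N θ Mstar 𝔠 x).Δ2 U A b) =
      2 * ∑ b, Matrix.trace (HDY x.toKIdx (parSymY x.toKIdx) (parBY x.toKIdx) (GpPhysY x.toKIdx (parSymY x.toKIdx)) U ((𝔠 x).form U A A') b *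
        JY x.toKIdx U b) :=
  trPairY_res134OfC2YP (trDualMatY N) x (𝔠 x) U A A'

/-- the record's `Δ⁽²⁾(U)` fed `G′_phys` is trace-symmetric. [cite: Balaban1985BackgroundPropagators, (3.134) p.422] -/
theorem sum_trace_resYOfC2P_Δ2_symm (x : MemberY θ.d₆ θ.ℓ₆ θ.hd' θ.hL' θ.b₀ θ.b₁ Mstar) (U : CfgY (Matrix (Fin N) (Fin N) ℂ) x.toKIdx)
    (A B : FBondY x.toKIdx → Matrix (Fin N) (Fin N) ℂ) :
    ∑ b, Matrix.trace ((resYOfC2P N θ Mstar 𝔠 x).Δ2 U A b * B b) = ∑ b, Matrix.trace (A b * (resYOfC2P N θ Mstar 𝔠 x).Δ2 U B b) :=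
  trPairY_res134OfC2YP_symm (trDualMatY N) x (𝔠 x) U A B

/-- the flat `C⁽²⁾` family reproduces the flat residual family's `Δ⁽²⁾ = 0`. [cite: Balaban1985BackgroundPropagators, (3.134) p.422, bookkeeping] -/
theorem resYOfC2P_flat_Δ2 (x : MemberY θ.d₆ θ.ℓ₆ θ.hd' θ.hL' θ.b₀ θ.b₁ Mstar) (U : CfgY (Matrix (Fin N) (Fin N) ℂ) x.toKIdx) :
    (resYOfC2P N θ Mstar (c2Y_flat N θ Mstar) x).Δ2 U = (resY_flat N θ Mstar x).Δ2 U :=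
  res134OfC2YP_flat_Δ2 (trDualMatY N) x U

/-- ★ `resYOfC2P 𝔠` is a COVARIANT residual family for a covariant `𝔠` (the `_cov` twin of `resYOfC2_Δ2_isCovBondOpY`).
[cite: Balaban1985BackgroundPropagators, (3.134) p.422, (3.34) p.396] -/
theorem resYOfC2P_Δ2_isCovBondOpY (hC : 𝔠.IsCov) (x : MemberY θ.d₆ θ.ℓ₆ θ.hd' θ.hL' θ.b₀ θ.b₁ Mstar) :
    IsCovBondOpY x.toKIdx ((resYOfC2P N θ Mstar 𝔠 x).Δ2) :=
  res134OfC2YP_Δ2_isCovBondOpY (trDualMatY N) x (𝔠 x) (hC x)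

end Record

/-! ## §3 Reality at a unitary background and ★★★ the certificate's `hΔ2` at `𝔯 := resYOfC2P 𝔠` -/

section RealMember

variable {N : ℕ} {d ℓ : ℕ} {hd : 1 ≤ d + 1} {hL : Odd (ℓ + 1) ∧ 1 < ℓ + 1} {b₀ b₁ : ℝ} (i : KIdx d ℓ hd hL b₀ b₁)
variable {U : CfgY (Matrix (Fin N) (Fin N) ℂ) i}

/-- ★ `G′_phys(U) = η²·G′(U)` over the symmetrised transporters is real at a unitary background (`IsRealOpY.smul_real` on def-Y's
`GpY_parSymY_isRealOpY`).  The same statement is proved as `B1Eq324BenfattoClassSectEMemberPrecisionDoorRecordV4PAdjCurrent.GpPhysY_parSymY_isRealOpY`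
(the N05 precision-door file, :156); it is RESTATED here, under a distinct stem, because that file sits ABOVE NODE 00 in the import graph (it imports the
`B1Eq324…PivotLines` layer) and cannot be imported by a `Node00/` module. [cite: Balaban1985BackgroundPropagators, (3.25) p.395, p.391 (hermitian-valued functions)] -/
theorem isRealOpY_GpPhysY_parSymY (hU : ∀ μ x, U μ x ∈ B7Prop2Explicit.unitaryUnits (Matrix (Fin N) (Fin N) ℂ)) :
    IsRealOpY (GpPhysY i (parSymY i) U) := by
  rw [GpPhysY_apply]
  exact IsRealOpY.smul_real _ (GpY_parSymY_isRealOpY i hU)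

/-- ★ the v4P record's `H(U)` (fed `G′_phys`) is real at a unitary background. [cite: Balaban1985BackgroundPropagators, (3.126) p.420] -/
theorem HDY_physY_record_isRealOpY (hU : ∀ μ x, U μ x ∈ B7Prop2Explicit.unitaryUnits (Matrix (Fin N) (Fin N) ℂ)) :
    IsRealOpY (HDY i (parSymY i) (parBY i) (GpPhysY i (parSymY i)) U) :=
  HDY_isRealOpY i U (mem_unitary_of_mem_unitaryUnits i hU) (parSymY i) (parBY i) (GpPhysY i (parSymY i)) (parSymY_mem_unitary i hU)
    (parBY_mem_unitary i hU) (isRealOpY_GpPhysY_parSymY i hU)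

/-- ★ `H(U)(X⋆) = (H(U)X)⋆` at the v4P tables of record, for every unitary-valued background. [cite: Balaban1985BackgroundPropagators, (3.126) p.420, p.391] -/
theorem HDY_physY_star_of_unitary (hU : ∀ μ x, U μ x ∈ B7Prop2Explicit.unitaryUnits (Matrix (Fin N) (Fin N) ℂ))
    (X : IBondY i → Matrix (Fin N) (Fin N) ℂ) :
    HDY i (parSymY i) (parBY i) (GpPhysY i (parSymY i)) U (star X) = star (HDY i (parSymY i) (parBY i) (GpPhysY i (parSymY i)) U X) :=
  HDY_physY_record_isRealOpY i hU X

end RealMember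

section RealRecord

variable {N : ℕ} (θ : Stage3Params) (Mstar : ℕ) (𝔠 : C2Y N θ Mstar)

/-- ★ **`hH` FOR THE v4P RECORD**: `H(U)(X⋆) = (H(U)X)⋆` with `H` fed `G′_phys`, at every `SU(N)`-valued background.
[cite: Balaban1985BackgroundPropagators, (3.126) p.420, p.390 (G ⊂ U(N))] -/
theorem hH_of_recordP :
    ∀ (x : MemberY θ.d₆ θ.ℓ₆ θ.hd' θ.hL' θ.b₀ θ.b₁ Mstar) (U : CfgY (Matrix (Fin N) (Fin N) ℂ) x.toKIdx), (∀ μ z, U μ z ∈ specialUnitaryUnits (Fin N)) →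
      ∀ X : IBondY x.toKIdx → Matrix (Fin N) (Fin N) ℂ,
        HDY x.toKIdx (parSymY x.toKIdx) (parBY x.toKIdx) (GpPhysY x.toKIdx (parSymY x.toKIdx)) U (star X) =
          star (HDY x.toKIdx (parSymY x.toKIdx) (parBY x.toKIdx) (GpPhysY x.toKIdx (parSymY x.toKIdx)) U X) :=
  fun x _ hU X => HDY_physY_star_of_unitary x.toKIdx (fun μ z => specialUnitaryUnits_le_unitaryUnits (hU μ z)) X

/-- ★★ **THE RECORD's `Δ⁽²⁾(U)` FED `G′_phys` IS REAL at a unitary-valued `U` for a real `C⁽²⁾(U)`** (`H`'s reality discharged by `HDY_physY_star_of_unitary`).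
[cite: Balaban1985BackgroundPropagators, (3.134) p.422, p.396 («values in G»)] -/
theorem resYOfC2P_Δ2_star (x : MemberY θ.d₆ θ.ℓ₆ θ.hd' θ.hL' θ.b₀ θ.b₁ Mstar) {U : CfgY (Matrix (Fin N) (Fin N) ℂ) x.toKIdx}
    (hU : ∀ μ y, U μ y ∈ B7Prop2Explicit.unitaryUnits (Matrix (Fin N) (Fin N) ℂ))
    (hC : ∀ A A' : FBondY x.toKIdx → Matrix (Fin N) (Fin N) ℂ, (𝔠 x).form U (star A) (star A') = star ((𝔠 x).form U A A'))
    (A : FBondY x.toKIdx → Matrix (Fin N) (Fin N) ℂ) :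
    (resYOfC2P N θ Mstar 𝔠 x).Δ2 U (star A) = star ((resYOfC2P N θ Mstar 𝔠 x).Δ2 U A) :=
  delta2OfY_star_of_unitary x.toKIdx (trDualMatY N) _ _ _ _ trDualMatY_τ_star (star_eq_inv_of_mem_unitaryUnits x.toKIdx hU) hC
    (HDY_physY_star_of_unitary x.toKIdx hU) A

/-- the record's residual letter fed `G′_phys` is a real operator at a unitary background, for a real `C⁽²⁾(U)`.
[cite: Balaban1985BackgroundPropagators, (3.134) p.422, bookkeeping] -/
theorem resYOfC2P_Δ2_isRealOpY (x : MemberY θ.d₆ θ.ℓ₆ θ.hd' θ.hL' θ.b₀ θ.b₁ Mstar) {U : CfgY (Matrix (Fin N) (Fin N) ℂ) x.toKIdx}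
    (hU : ∀ μ y, U μ y ∈ B7Prop2Explicit.unitaryUnits (Matrix (Fin N) (Fin N) ℂ))
    (hC : ∀ A A' : FBondY x.toKIdx → Matrix (Fin N) (Fin N) ℂ, (𝔠 x).form U (star A) (star A') = star ((𝔠 x).form U A A')) :
    IsRealOpY ((resYOfC2P N θ Mstar 𝔠 x).Δ2 U) :=
  fun A => resYOfC2P_Δ2_star θ Mstar 𝔠 x hU hC A

/-- ★★ **`Δ⁽²⁾(U)` FED `G′_phys` IS SYMMETRIC IN def-Y's HERMITIAN CURRENCY** (`IsSymmTr 1`) at a unitary-valued background, modulo the reality of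
[5]'s `C⁽²⁾(U)` alone — so `G₁_isSymmTr` ∕ `GG_isSymmTr` of the v4P record apply to `𝔯 := resYOfC2P 𝔠`.
[cite: Balaban1985BackgroundPropagators, (3.134) p.422, Thm 3.11 p.416, (3.153) p.426] -/
theorem resYOfC2P_Δ2_isSymmTr (x : MemberY θ.d₆ θ.ℓ₆ θ.hd' θ.hL' θ.b₀ θ.b₁ Mstar) {U : CfgY (Matrix (Fin N) (Fin N) ℂ) x.toKIdx}
    (hU : ∀ μ y, U μ y ∈ B7Prop2Explicit.unitaryUnits (Matrix (Fin N) (Fin N) ℂ))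
    (hC : ∀ A A' : FBondY x.toKIdx → Matrix (Fin N) (Fin N) ℂ, (𝔠 x).form U (star A) (star A') = star ((𝔠 x).form U A A')) :
    IsSymmTr (fun _ => (1 : ℝ)) ((resYOfC2P N θ Mstar 𝔠 x).Δ2 U) :=
  isSymmTr_of_trSymm_of_real _ (sum_trace_resYOfC2P_Δ2_symm N θ Mstar 𝔠 x U) (resYOfC2P_Δ2_star θ Mstar 𝔠 x hU hC)

/-- ★★★ **THE N06 CERTIFICATE's DISPLAYED BINDER `hΔ2` AS A THEOREM at `𝔯 := resYOfC2P 𝔠`**: at every `SU(N)`-valued background the record's residual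
letter fed `G′_phys` is symmetric for the Hermitian trace pairing, given ONLY the displayed reality letter of [5]'s form `C⁽²⁾` at `SU(N)`-valued backgrounds
(`h𝔠real`).  Consumer: `hΔ2 := resYOfC2P_Δ2_isSymmTr_SU θ.toStage3Params Mstar 𝔠 h𝔠real`.
[cite: Balaban1985BackgroundPropagators, (3.134) p.422, Thm 3.11 p.416, p.390 (G ⊂ U(N))] -/
theorem resYOfC2P_Δ2_isSymmTr_SU
    (h𝔠real : ∀ (x : MemberY θ.d₆ θ.ℓ₆ θ.hd' θ.hL' θ.b₀ θ.b₁ Mstar) (U : CfgY (Matrix (Fin N) (Fin N) ℂ) x.toKIdx),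
      (∀ μ z, U μ z ∈ specialUnitaryUnits (Fin N)) →
        ∀ A A' : FBondY x.toKIdx → Matrix (Fin N) (Fin N) ℂ, (𝔠 x).form U (star A) (star A') = star ((𝔠 x).form U A A')) :
    ∀ (x : MemberY θ.d₆ θ.ℓ₆ θ.hd' θ.hL' θ.b₀ θ.b₁ Mstar) (U : CfgY (Matrix (Fin N) (Fin N) ℂ) x.toKIdx),
      (∀ μ z, U μ z ∈ specialUnitaryUnits (Fin N)) → IsSymmTr (fun _ => (1 : ℝ)) ((resYOfC2P N θ Mstar 𝔠 x).Δ2 U) :=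
  fun x U hU => resYOfC2P_Δ2_isSymmTr θ Mstar 𝔠 x (fun μ z => specialUnitaryUnits_le_unitaryUnits (hU μ z)) (h𝔠real x U hU)

/-- the same with `U` ranging over the certificate's background class `(bg9YR … (specialUnitaryUnits (Fin N)) R₁ R₂ x).Cfg` is literally the above
(`.Cfg` unfolds to `CfgY`); recorded as the real-operator form for the `IsRealOpY` consumers of `OpsYSectDReal` §RecordMember.
[cite: Balaban1985BackgroundPropagators, (3.134) p.422, bookkeeping] -/
theorem resYOfC2P_Δ2_isRealOpY_SU
    (h𝔠real : ∀ (x : MemberY θ.d₆ θ.ℓ₆ θ.hd' θ.hL' θ.b₀ θ.b₁ Mstar) (U : CfgY (Matrix (Fin N) (Fin N) ℂ) x.toKIdx),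
      (∀ μ z, U μ z ∈ specialUnitaryUnits (Fin N)) →
        ∀ A A' : FBondY x.toKIdx → Matrix (Fin N) (Fin N) ℂ, (𝔠 x).form U (star A) (star A') = star ((𝔠 x).form U A A'))
    (x : MemberY θ.d₆ θ.ℓ₆ θ.hd' θ.hL' θ.b₀ θ.b₁ Mstar) {U : CfgY (Matrix (Fin N) (Fin N) ℂ) x.toKIdx} (hU : ∀ μ z, U μ z ∈ specialUnitaryUnits (Fin N)) :
    IsRealOpY ((resYOfC2P N θ Mstar 𝔠 x).Δ2 U) :=
  resYOfC2P_Δ2_isRealOpY θ Mstar 𝔠 x (fun μ z => specialUnitaryUnits_le_unitaryUnits (hU μ z)) (h𝔠real x U hU)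

end RealRecord

end Literature.MathematicalPhysics.QuantumFieldTheory.Balaban1983to89.Node00

end
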